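import Summits.QuantumFields.BalabanUV.Beta.FP.CoarseJetOrderOne

/-!
# `BalabanUV.Beta.FP.CoarseJetOrderTwo` — road «FP» (binder row D1), ROUTE T, the (T-INV) ∕ (T-ID) junction at ORDER 2:
# THE COARSE SECOND JET OF THE TORUS CALL IN CLOSED FORM — the `μμ` block of the order-2 effective-form word is a polynomial in the
# four torus blocks `Θ` (minimiser), `Θᴸ` (left companion), `Ŝ` (effective form), `Γ̂` (fluctuation covariance) and the level-`j` jets
# `H₁ H₂ Q₁₁ Q₁₂`; the dictionary's `hId₂` becomes ONE explicit identity between periodised kernels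

HONEST DEPENDENCY (page 1, mandatory): continuum YM on T⁴ ⇐ BetaPertH ∧ nine spine estimates (0/9 proved); BetaPertH ⇐ (D1) ∧ (D4) ∧
CAP+tail; G-an2-4 gates asym, D1 and NE2/3/4.  HONEST FRAMING (cell contract, verbatim): «discharging `BetaPertH` makes Bałaban's UV
stability UNCONDITIONAL — a real constructive-QFT result; it is NOT the continuum limit and NOT the Clay problem.»  ABSOLUTE RULE (cell
charter, verbatim): «No internally-minted statement may enter as a cited fact. Every hypothesis is either kernel-proved in this package or a
verbatim quotation of a PUBLISHED theorem with page reference. The manuscript(s) under audit are NOT citable for their own disputed steps — they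
are the thing under adjudication; programme-internal (2001/route/tribunal) claims are never citable.»  THIS MODULE is [folklore] finite-dimensional
bookkeeping BY NAME over `RelInvPeriodisedEffForm.effForm_toBlocks₁₁_eq_perF_KInvStep` (p314950) and `RelInvPeriodisedMinOpRecord.torus_minOp_submatrix_inl
∕ torus_minOpL_submatrix_inl ∕ torus_flucCov_eq`.  No `Prop`, no `def`, nothing cited, 0 sorry.  «not in print; our bookkeeping».

WHY.  In `NestedStepLawOneShotJets.secondVar_oneShot_nestedStepLaw_jets` (p308750) ∕ the torus call (p313662, `…Delta` p316503) the COARSE second jet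
is the `μμ` block of the order-2 word (the (J-E′) second jet `𝔊̈` of `EffectiveFormJetsMovingBorder` with `Ġ = G̈ = 0` border jets `B = [Q₁₁;0]`,
`[Q₁₂;0]`).  `CoarseJetOrderOne` did order 1; here the same two steps at order 2: §1 the `μμ` block sees only `L_{μ·}`, `I_{·μ}`, `S₁₁` and the FULL
fluctuation covariance `Γ` (pure algebra); §2 on the torus those four blocks are `−Θᴸ`, `Θ`, `Ŝ`, `Γ̂` (the presentation of record), so the
dictionary's `hId₂` (Q-FP-16-5 order 2, an2 — DISPLAYED verbatim everywhere) is EQUIVALENT to one explicit polynomial identity.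

CONTENT.
* §1 `orderTwo_word_toBlocks₁₁` (generic, any field).
* §2 **`torus_orderTwo_word_toBlocks₁₁`** (presentation of record on any box `M` with `Lc ∣ Mᵢ`; the four torus blocks NAMED by hypotheses
  `hΘ hΘL hŜ hΓ̂` to keep the statement readable) and **`torus_hId₂_iff`**.
WHAT IT IS NOT: NOT a proof of `hId₂`; NOT (T-ID), NOT SDF, NOT D1, NOT BetaPertH, NOT continuum, NOT Clay; discharges NO binder of row D1 by itself;
0 estimates.  Unit `b2b-balaban-beta-d1-formalise-leaf-05` (gen 26), 2026-08-22.
-/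

noncomputable section

open scoped BigOperators Matrix

namespace Summit.QuantumFields.BalabanUV.Beta.FP.CoarseJetOrderTwo

open Matrix
open Literature.Probability.LatticeModels (Torus.proj)
open Literature.MathematicalPhysics.QuantumFieldTheory.Balaban1983to89
open Literature.MathematicalPhysics.QuantumFieldTheory.Balaban1983to89.Beta
open Literature.MathematicalPhysics.QuantumFieldTheory.Balaban1983to89.Beta.Composition (kkt)
open Literature.MathematicalPhysics.QuantumFieldTheory.Balaban1983to89.Beta.CompositionSingular (effForm flucCov minOp minOpL)
open B6Lemma24Torus (pbox)
open AffineAveraging (Site box toSite)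
open OneStepResolventKernel (Fib)
open OneStepKernelFamily (KInvStep)
open Summit.QuantumFields.BalabanUV.Beta.AxialDressingRooted (coDressKBmAt axEc)
open Summit.QuantumFields.BalabanUV.Beta.BorderedHessian (bhKStepAt)
open Summit.QuantumFields.BalabanUV.Beta.FP.KernelPeriodisationFib (Idx perF)
open Summit.QuantumFields.BalabanUV.Beta.FP.TorusCombRows (Res combRowsT)
open Summit.QuantumFields.BalabanUV.Beta.FP.RelInvPeriodisedEffForm (effForm_toBlocks₁₁_eq_perF_KInvStep)
open Summit.QuantumFields.BalabanUV.Beta.FP.RelInvPeriodisedMinOpRecord (torus_minOp_submatrix_inl torus_minOpL_submatrix_inl torus_flucCov_eq)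

/-! ## §1 Generic: the `μμ` block of the order-2 effective-form word sees only four blocks -/

section Generic

variable {𝕜 : Type*} [Field 𝕜]
variable {ν μ ρ₁ : Type*} [Fintype ν] [Fintype μ] [Fintype ρ₁]

/-- [folklore] **THE `μμ` BLOCK OF THE ORDER-2 WORD**: for `B = [Q₁₁;0]` and the border second jet `[Q₁₂;0]`, the `μμ` block of p308750's order-2
effective-form word is the SAME word with `L ↦ L_{μ·}`, `I ↦ I_{·μ}`, `S ↦ S₁₁`, `B ↦ Q₁₁`, `[Q₁₂;0] ↦ Q₁₂` (and `Γ` unchanged) — the slice-multiplier rows ∕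
columns never enter the coarse second jet. -/
theorem orderTwo_word_toBlocks₁₁ (H₁ H₂ : Matrix ν ν 𝕜) (Q₁₁ Q₁₂ : Matrix μ ν 𝕜) (Γ : Matrix ν ν 𝕜)
    (I : Matrix ν (μ ⊕ ρ₁) 𝕜) (L : Matrix (μ ⊕ ρ₁) ν 𝕜) (S : Matrix (μ ⊕ ρ₁) (μ ⊕ ρ₁) 𝕜) {B : Matrix (μ ⊕ ρ₁) ν 𝕜}
    (hB : fromRows Q₁₁ (0 : Matrix ρ₁ ν 𝕜) = B) :
    (((-((L * H₁ - S * B) * Γ + L * Bᵀ * L) * H₁ + L * H₂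
          - (((L * H₁ - S * B) * I - L * Bᵀ * S) * B + S * fromRows Q₁₂ (0 : Matrix ρ₁ ν 𝕜))) * I
        + (L * H₁ - S * B) * (-((Γ * H₁ + I * B) * I - Γ * Bᵀ * S)))
      - ((-((L * H₁ - S * B) * Γ + L * Bᵀ * L) * Bᵀ + L * (fromRows Q₁₂ (0 : Matrix ρ₁ ν 𝕜))ᵀ) * S
          + L * Bᵀ * ((L * H₁ - S * B) * I - L * Bᵀ * S))).toBlocks₁₁
      = ((-((L.submatrix Sum.inl id * H₁ - S.toBlocks₁₁ * Q₁₁) * Γ + L.submatrix Sum.inl id * Q₁₁ᵀ * L.submatrix Sum.inl id) * H₁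
            + L.submatrix Sum.inl id * H₂
            - (((L.submatrix Sum.inl id * H₁ - S.toBlocks₁₁ * Q₁₁) * I.submatrix id Sum.inl - L.submatrix Sum.inl id * Q₁₁ᵀ * S.toBlocks₁₁) * Q₁₁
                + S.toBlocks₁₁ * Q₁₂)) * I.submatrix id Sum.inl
          + (L.submatrix Sum.inl id * H₁ - S.toBlocks₁₁ * Q₁₁)
              * (-((Γ * H₁ + I.submatrix id Sum.inl * Q₁₁) * I.submatrix id Sum.inl - Γ * Q₁₁ᵀ * S.toBlocks₁₁)))
        - ((-((L.submatrix Sum.inl id * H₁ - S.toBlocks₁₁ * Q₁₁) * Γ + L.submatrix Sum.inl id * Q₁₁ᵀ * L.submatrix Sum.inl id) * Q₁₁ᵀ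
              + L.submatrix Sum.inl id * Q₁₂ᵀ) * S.toBlocks₁₁
            + L.submatrix Sum.inl id * Q₁₁ᵀ
              * ((L.submatrix Sum.inl id * H₁ - S.toBlocks₁₁ * Q₁₁) * I.submatrix id Sum.inl - L.submatrix Sum.inl id * Q₁₁ᵀ * S.toBlocks₁₁)) := by
  subst hB
  ext a a'
  simp only [Matrix.toBlocks₁₁, of_apply, Matrix.sub_apply, Matrix.add_apply, Matrix.neg_apply, Matrix.mul_apply, submatrix_apply, id_eq,
    transpose_apply, Fintype.sum_sum_type, fromRows_apply_inl, fromRows_apply_inr, Matrix.zero_apply, mul_zero, zero_mul, add_zero,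
    Finset.sum_const_zero, sub_mul, add_mul, neg_mul, Finset.sum_sub_distrib, Finset.sum_add_distrib, Finset.sum_neg_distrib]

end Generic

/-! ## §2 At the record: the coarse second jet as a polynomial in the four torus blocks -/

section Record

variable {d : ℕ} {Lc : ℕ} [NeZero Lc] {r : Fin (d + 1) → ℕ} (M : Fin (d + 1) → ℕ) [∀ μ, NeZero (M μ)]

set_option synthInstance.maxSize 1024 in
/-- **[folklore] THE COARSE SECOND JET OF THE TORUS CALL IN CLOSED FORM.**  On any box `M` with `Lc ∣ Mᵢ`, root `r ∈ box (d+1) Lc`, at the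
presentation of record (`hH₀ hQ₁₀ hτ₁`; coarse multipliers by any injective `inr`-valued `fμ` with `hcoarse`; p308750's namings `hΓ hI hL hS hB`), with the
four TORUS BLOCKS NAMED: `hΘ : Θ = of (fun (s,α) a ↦ axEc s s (inl α) (inl α) · Â (s, inl α) (fμ a))` (minimiser), `hΘL : Θᴸ = of (fun a (s,α) ↦ axEc · Â (fμ a) (s, inl α))`
(left companion, up to sign), `hŜ : Ŝ = (perF M (KInvStep Lc j))∘(fμ,fμ)` (effective form), `hΓc : Γ̂ = of (fun b b' ↦ axEc b · (axEc b' · Â b b'))`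
(fluctuation covariance), `Â := perF M (coDressKBmAt (toSite r) Lc (KInvStep Lc j))`: for ANY jets `H₁ H₂ Q₁₁ Q₁₂`, the `μμ` block of the order-2 word equals
the §1 polynomial with `L_{μ·} := −Θᴸ`, `I_{·μ} := Θ`, `S₁₁ := Ŝ`, `Γ := Γ̂`. -/
theorem torus_orderTwo_word_toBlocks₁₁ (hr : r ∈ box (d + 1) Lc) (hM : ∀ i, Lc ∣ M i) (j : ℕ)
    {μ : Type*} [Fintype μ] [DecidableEq μ] (fμ : μ → Idx M (Fib d)) (hfμ : Function.Injective fμ)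
    (hμ : ∀ a : μ, ∃ m : Fin (d + 1), (fμ a).2 = Sum.inr m)
    (hcoarse : ∀ (s : ↥(pbox M)) (m : Fin (d + 1)), ((s, Sum.inr m) : Idx M (Fib d)) ∈ Set.range fμ ↔ Torus.proj Lc (s : Site (d + 1)) = 0)
    {H₀ : Matrix (↥(pbox M) × Fin (d + 1)) (↥(pbox M) × Fin (d + 1)) ℝ} {Q₁₀ : Matrix μ (↥(pbox M) × Fin (d + 1)) ℝ}
    {τ₁ : Matrix (Res (toSite r) Lc M) (↥(pbox M) × Fin (d + 1)) ℝ}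
    (hH₀ : H₀ = (perF M (bhKStepAt d (toSite r) Lc j)).submatrix
        (fun b : ↥(pbox M) × Fin (d + 1) => ((b.1, Sum.inl b.2) : Idx M (Fib d))) (fun b : ↥(pbox M) × Fin (d + 1) => ((b.1, Sum.inl b.2) : Idx M (Fib d))))
    (hQ₁₀ : Q₁₀ = (perF M (bhKStepAt d (toSite r) Lc j)).submatrix fμ (fun b : ↥(pbox M) × Fin (d + 1) => ((b.1, Sum.inl b.2) : Idx M (Fib d))))
    (hτ₁ : τ₁ = (combRowsT (toSite r) Lc M).submatrix id (fun b : ↥(pbox M) × Fin (d + 1) => ((b.1, Sum.inl b.2) : Idx M (Fib d))))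
    {Γ : Matrix (↥(pbox M) × Fin (d + 1)) (↥(pbox M) × Fin (d + 1)) ℝ}
    {I : Matrix (↥(pbox M) × Fin (d + 1)) (μ ⊕ Res (toSite r) Lc M) ℝ} {L : Matrix (μ ⊕ Res (toSite r) Lc M) (↥(pbox M) × Fin (d + 1)) ℝ}
    {S : Matrix (μ ⊕ Res (toSite r) Lc M) (μ ⊕ Res (toSite r) Lc M) ℝ} {B : Matrix (μ ⊕ Res (toSite r) Lc M) (↥(pbox M) × Fin (d + 1)) ℝ}
    (hΓ : flucCov H₀ (fromRows Q₁₀ τ₁) = Γ) (hI : minOp H₀ (fromRows Q₁₀ τ₁) = I) (hL : minOpL H₀ (fromRows Q₁₀ τ₁) = L)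
    (hS : effForm H₀ (fromRows Q₁₀ τ₁) = S)
    (H₁ H₂ : Matrix (↥(pbox M) × Fin (d + 1)) (↥(pbox M) × Fin (d + 1)) ℝ) (Q₁₁ Q₁₂ : Matrix μ (↥(pbox M) × Fin (d + 1)) ℝ)
    (hB : fromRows Q₁₁ (0 : Matrix (Res (toSite r) Lc M) (↥(pbox M) × Fin (d + 1)) ℝ) = B)
    -- the four torus blocks, NAMED
    {Θ : Matrix (↥(pbox M) × Fin (d + 1)) μ ℝ} {ΘL : Matrix μ (↥(pbox M) × Fin (d + 1)) ℝ} {Ŝ : Matrix μ μ ℝ}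
    {Γc : Matrix (↥(pbox M) × Fin (d + 1)) (↥(pbox M) × Fin (d + 1)) ℝ}
    (hΘ : Θ = Matrix.of fun (b : ↥(pbox M) × Fin (d + 1)) (a : μ) =>
        axEc (toSite r) Lc (b.1 : Site (d + 1)) (b.1 : Site (d + 1)) (Sum.inl b.2) (Sum.inl b.2)
          * perF M (coDressKBmAt (toSite r) Lc (KInvStep (d := d) Lc j)) (b.1, Sum.inl b.2) (fμ a))
    (hΘL : ΘL = Matrix.of fun (a : μ) (b : ↥(pbox M) × Fin (d + 1)) =>
        axEc (toSite r) Lc (b.1 : Site (d + 1)) (b.1 : Site (d + 1)) (Sum.inl b.2) (Sum.inl b.2)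
          * perF M (coDressKBmAt (toSite r) Lc (KInvStep (d := d) Lc j)) (fμ a) (b.1, Sum.inl b.2))
    (hŜ : Ŝ = (perF M (KInvStep (d := d) Lc j)).submatrix fμ fμ)
    (hΓc : Γc = Matrix.of fun (b b' : ↥(pbox M) × Fin (d + 1)) =>
        axEc (toSite r) Lc (b.1 : Site (d + 1)) (b.1 : Site (d + 1)) (Sum.inl b.2) (Sum.inl b.2)
          * (axEc (toSite r) Lc (b'.1 : Site (d + 1)) (b'.1 : Site (d + 1)) (Sum.inl b'.2) (Sum.inl b'.2)
            * perF M (coDressKBmAt (toSite r) Lc (KInvStep (d := d) Lc j)) (b.1, Sum.inl b.2) (b'.1, Sum.inl b'.2))) :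
    (((-((L * H₁ - S * B) * Γ + L * Bᵀ * L) * H₁ + L * H₂
          - (((L * H₁ - S * B) * I - L * Bᵀ * S) * B
              + S * fromRows Q₁₂ (0 : Matrix (Res (toSite r) Lc M) (↥(pbox M) × Fin (d + 1)) ℝ))) * I
        + (L * H₁ - S * B) * (-((Γ * H₁ + I * B) * I - Γ * Bᵀ * S)))
      - ((-((L * H₁ - S * B) * Γ + L * Bᵀ * L) * Bᵀ
            + L * (fromRows Q₁₂ (0 : Matrix (Res (toSite r) Lc M) (↥(pbox M) × Fin (d + 1)) ℝ))ᵀ) * S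
          + L * Bᵀ * ((L * H₁ - S * B) * I - L * Bᵀ * S))).toBlocks₁₁
      = ((-((-ΘL * H₁ - Ŝ * Q₁₁) * Γc + -ΘL * Q₁₁ᵀ * -ΘL) * H₁ + -ΘL * H₂
            - (((-ΘL * H₁ - Ŝ * Q₁₁) * Θ - -ΘL * Q₁₁ᵀ * Ŝ) * Q₁₁ + Ŝ * Q₁₂)) * Θ
          + (-ΘL * H₁ - Ŝ * Q₁₁) * (-((Γc * H₁ + Θ * Q₁₁) * Θ - Γc * Q₁₁ᵀ * Ŝ)))
        - ((-((-ΘL * H₁ - Ŝ * Q₁₁) * Γc + -ΘL * Q₁₁ᵀ * -ΘL) * Q₁₁ᵀ + -ΘL * Q₁₂ᵀ) * Ŝ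
            + -ΘL * Q₁₁ᵀ * ((-ΘL * H₁ - Ŝ * Q₁₁) * Θ - -ΘL * Q₁₁ᵀ * Ŝ)) := by
  rw [orderTwo_word_toBlocks₁₁ H₁ H₂ Q₁₁ Q₁₂ Γ I L S hB, ← hΓ, ← hI, ← hL, ← hS, hH₀, hQ₁₀, hτ₁,
    torus_minOp_submatrix_inl M hr hM j fμ hfμ hμ hcoarse, torus_minOpL_submatrix_inl M hr hM j fμ hfμ hμ hcoarse,
    effForm_toBlocks₁₁_eq_perF_KInvStep M hr hM j fμ hfμ hμ hcoarse, torus_flucCov_eq M hr hM j fμ hfμ hμ hcoarse, hΘ, hΘL, hŜ, hΓc]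

set_option synthInstance.maxSize 1024 in
/-- **[folklore] THE DICTIONARY's `hId₂` IS ONE POLYNOMIAL IDENTITY IN THE FOUR TORUS BLOCKS.**  In the setting of `torus_orderTwo_word_toBlocks₁₁`,
for any scalar `c` and any candidate level-`(j+1)` second insertion table `H'₂`: `hId₂ : (order-2 word).toBlocks₁₁ = c • H'₂ ↔ (§2's polynomial) = c • H'₂`. -/
theorem torus_hId₂_iff (hr : r ∈ box (d + 1) Lc) (hM : ∀ i, Lc ∣ M i) (j : ℕ)
    {μ : Type*} [Fintype μ] [DecidableEq μ] (fμ : μ → Idx M (Fib d)) (hfμ : Function.Injective fμ)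
    (hμ : ∀ a : μ, ∃ m : Fin (d + 1), (fμ a).2 = Sum.inr m)
    (hcoarse : ∀ (s : ↥(pbox M)) (m : Fin (d + 1)), ((s, Sum.inr m) : Idx M (Fib d)) ∈ Set.range fμ ↔ Torus.proj Lc (s : Site (d + 1)) = 0)
    {H₀ : Matrix (↥(pbox M) × Fin (d + 1)) (↥(pbox M) × Fin (d + 1)) ℝ} {Q₁₀ : Matrix μ (↥(pbox M) × Fin (d + 1)) ℝ}
    {τ₁ : Matrix (Res (toSite r) Lc M) (↥(pbox M) × Fin (d + 1)) ℝ}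
    (hH₀ : H₀ = (perF M (bhKStepAt d (toSite r) Lc j)).submatrix
        (fun b : ↥(pbox M) × Fin (d + 1) => ((b.1, Sum.inl b.2) : Idx M (Fib d))) (fun b : ↥(pbox M) × Fin (d + 1) => ((b.1, Sum.inl b.2) : Idx M (Fib d))))
    (hQ₁₀ : Q₁₀ = (perF M (bhKStepAt d (toSite r) Lc j)).submatrix fμ (fun b : ↥(pbox M) × Fin (d + 1) => ((b.1, Sum.inl b.2) : Idx M (Fib d))))
    (hτ₁ : τ₁ = (combRowsT (toSite r) Lc M).submatrix id (fun b : ↥(pbox M) × Fin (d + 1) => ((b.1, Sum.inl b.2) : Idx M (Fib d))))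
    {Γ : Matrix (↥(pbox M) × Fin (d + 1)) (↥(pbox M) × Fin (d + 1)) ℝ}
    {I : Matrix (↥(pbox M) × Fin (d + 1)) (μ ⊕ Res (toSite r) Lc M) ℝ} {L : Matrix (μ ⊕ Res (toSite r) Lc M) (↥(pbox M) × Fin (d + 1)) ℝ}
    {S : Matrix (μ ⊕ Res (toSite r) Lc M) (μ ⊕ Res (toSite r) Lc M) ℝ} {B : Matrix (μ ⊕ Res (toSite r) Lc M) (↥(pbox M) × Fin (d + 1)) ℝ}
    (hΓ : flucCov H₀ (fromRows Q₁₀ τ₁) = Γ) (hI : minOp H₀ (fromRows Q₁₀ τ₁) = I) (hL : minOpL H₀ (fromRows Q₁₀ τ₁) = L)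
    (hS : effForm H₀ (fromRows Q₁₀ τ₁) = S)
    (H₁ H₂ : Matrix (↥(pbox M) × Fin (d + 1)) (↥(pbox M) × Fin (d + 1)) ℝ) (Q₁₁ Q₁₂ : Matrix μ (↥(pbox M) × Fin (d + 1)) ℝ)
    (hB : fromRows Q₁₁ (0 : Matrix (Res (toSite r) Lc M) (↥(pbox M) × Fin (d + 1)) ℝ) = B)
    {Θ : Matrix (↥(pbox M) × Fin (d + 1)) μ ℝ} {ΘL : Matrix μ (↥(pbox M) × Fin (d + 1)) ℝ} {Ŝ : Matrix μ μ ℝ}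
    {Γc : Matrix (↥(pbox M) × Fin (d + 1)) (↥(pbox M) × Fin (d + 1)) ℝ}
    (hΘ : Θ = Matrix.of fun (b : ↥(pbox M) × Fin (d + 1)) (a : μ) =>
        axEc (toSite r) Lc (b.1 : Site (d + 1)) (b.1 : Site (d + 1)) (Sum.inl b.2) (Sum.inl b.2)
          * perF M (coDressKBmAt (toSite r) Lc (KInvStep (d := d) Lc j)) (b.1, Sum.inl b.2) (fμ a))
    (hΘL : ΘL = Matrix.of fun (a : μ) (b : ↥(pbox M) × Fin (d + 1)) =>
        axEc (toSite r) Lc (b.1 : Site (d + 1)) (b.1 : Site (d + 1)) (Sum.inl b.2) (Sum.inl b.2)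
          * perF M (coDressKBmAt (toSite r) Lc (KInvStep (d := d) Lc j)) (fμ a) (b.1, Sum.inl b.2))
    (hŜ : Ŝ = (perF M (KInvStep (d := d) Lc j)).submatrix fμ fμ)
    (hΓc : Γc = Matrix.of fun (b b' : ↥(pbox M) × Fin (d + 1)) =>
        axEc (toSite r) Lc (b.1 : Site (d + 1)) (b.1 : Site (d + 1)) (Sum.inl b.2) (Sum.inl b.2)
          * (axEc (toSite r) Lc (b'.1 : Site (d + 1)) (b'.1 : Site (d + 1)) (Sum.inl b'.2) (Sum.inl b'.2)
            * perF M (coDressKBmAt (toSite r) Lc (KInvStep (d := d) Lc j)) (b.1, Sum.inl b.2) (b'.1, Sum.inl b'.2)))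
    (c : ℝ) (H'₂ : Matrix μ μ ℝ) :
    (((-((L * H₁ - S * B) * Γ + L * Bᵀ * L) * H₁ + L * H₂
          - (((L * H₁ - S * B) * I - L * Bᵀ * S) * B
              + S * fromRows Q₁₂ (0 : Matrix (Res (toSite r) Lc M) (↥(pbox M) × Fin (d + 1)) ℝ))) * I
        + (L * H₁ - S * B) * (-((Γ * H₁ + I * B) * I - Γ * Bᵀ * S)))
      - ((-((L * H₁ - S * B) * Γ + L * Bᵀ * L) * Bᵀ
            + L * (fromRows Q₁₂ (0 : Matrix (Res (toSite r) Lc M) (↥(pbox M) × Fin (d + 1)) ℝ))ᵀ) * S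
          + L * Bᵀ * ((L * H₁ - S * B) * I - L * Bᵀ * S))).toBlocks₁₁ = c • H'₂ ↔
      ((-((-ΘL * H₁ - Ŝ * Q₁₁) * Γc + -ΘL * Q₁₁ᵀ * -ΘL) * H₁ + -ΘL * H₂
            - (((-ΘL * H₁ - Ŝ * Q₁₁) * Θ - -ΘL * Q₁₁ᵀ * Ŝ) * Q₁₁ + Ŝ * Q₁₂)) * Θ
          + (-ΘL * H₁ - Ŝ * Q₁₁) * (-((Γc * H₁ + Θ * Q₁₁) * Θ - Γc * Q₁₁ᵀ * Ŝ)))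
        - ((-((-ΘL * H₁ - Ŝ * Q₁₁) * Γc + -ΘL * Q₁₁ᵀ * -ΘL) * Q₁₁ᵀ + -ΘL * Q₁₂ᵀ) * Ŝ
            + -ΘL * Q₁₁ᵀ * ((-ΘL * H₁ - Ŝ * Q₁₁) * Θ - -ΘL * Q₁₁ᵀ * Ŝ)) = c • H'₂ := by
  rw [torus_orderTwo_word_toBlocks₁₁ M hr hM j fμ hfμ hμ hcoarse hH₀ hQ₁₀ hτ₁ hΓ hI hL hS H₁ H₂ Q₁₁ Q₁₂ hB hΘ hΘL hŜ hΓc]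

end Record

end Summit.QuantumFields.BalabanUV.Beta.FP.CoarseJetOrderTwo

end
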